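import Summits.RiemannHypothesis.RiemannHypothesis.Theorems.WeilWindowFlowWindowLipschitzStubSurplusReductionAux

/-!
# Stub `stub_surplusReduction` of line `borderline-barrier` for crux `WeilWindowFlow.WindowLipschitz`
(item stmt-RiemannHypothesis-1039, route route-RiemannHypothesis-WeilWindowFlow; registered
skeleton rev 2, stub S1a)

**What is proved.** For the explicit two-scale barrier of the window `a` frozen at depth `d₀`
(`2d₀ ≤ 1`, `d₀ < a`),
`B(x) = (log(1/min(a − |x|, d₀)))^{-1/2}` for `|x| < a` and `B(x) = 0` otherwise, and a point `y`
of the edge layer at depth `d = a − |y| ∈ (0, d₀)`, the integrand of the archimedean jump operator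
`(L B)(y) = ∫₀^∞ (2B(y) − B(y+t) − B(y−t)) ρ(t) dt` (`ρ = weilArchDensity`) is integrable on
`(0, ∞)` and

`(L B)(y) ≥ W(d)(½ log(1/d) − 1) − J − β₀ d₀ − (β₀ − W(d))(½ log(1/(d₀ − d)) + 3)`,

`W(s) = (log(1/s))^{-1/2}`, `β₀ = W(d₀)`, `J = ∫₀^{d₀−d} (W(d+s) − W(d)) ds/(2s)`.

**Proof route.** By evenness of `B` we may take `y = a − d > 0`. Then `B(y) = W(d)`; outward,
`B(y + t) = W(d − t) ≤ W(d)` for `t < d` and `B(y + t) = 0` for `t ≥ d`; inward,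
`B(y − t) = W(d + t)` for `t ≤ d₀ − d`, and `0 ≤ B ≤ β₀` everywhere. Splitting the integrand as
`(W(d) − B(y+t))ρ + (W(d) − B(y−t))ρ` (both integrable on `(0,∞)`: bounded near `0` by the
algebraic Lipschitz estimate of `W`, dominated by `β₀ρ` away from `0`):
* outward `≥ W(d) ∫_{(d,∞)} ρ ≥ W(d)(½ log(1/d) − 1)` (`ρ ≥ 1/(2t) − 1` on `(0,1]`, `ρ > 0`);
* inward on `(0, d₀ − d]`: `≥ −∫ (W(d+t) − W(d))(1/(2t) + 1) ≥ −J − β₀ d₀`;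
* inward on `(d₀ − d, ∞)`: `≥ (W(d) − β₀) ∫_{(d₀−d,∞)} ρ ≥ −(β₀ − W(d))(½ log(1/(d₀−d)) + 3)`
  (`ρ ≤ 1/(2t) + 1` on `(0,1]`, `∫_{(1,∞)} ρ ≤ 2`).
The one-variable facts and the evaluations of `B` live in the `…StubSurplusReductionAux` file.

Sources: idea card `borderline-barrier` (explicit version of the surplus computation);
the barrier architecture is that of H. Chen, T. Weth, *The Dirichlet problem for the logarithmic
Laplacian*, Comm. PDE 44 (2019), arXiv:1710.03416, §3, for the order-zero kernel `1/(2t)`.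
Everything below is elementary real analysis ([folklore]).
-/

set_option linter.dupNamespace false

noncomputable section

open MeasureTheory Set Filter
open scoped Topology ENNReal NNReal

namespace Summit.RiemannHypothesis.RiemannHypothesis.Theorems.WeilWindowFlowWindowLipschitz

open Literature.NumberTheory.LFunctions

variable {a d₀ d : ℝ} {B : ℝ → ℝ}

/-! ## The outward part `(W(d) − B(a − d + t)) ρ(t)` -/

/-- The outward part is integrable on `(0, ∞)`: on `(0, d/2]` it equals `(W(d) − W(d − t))ρ(t)`,
bounded by `(t/(d L₀√L₀)) · (1/t)`, `L₀ = log(1/d₀)`; on `(d/2, ∞)` it is dominated by `β₀ ρ`.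
[folklore] -/
theorem stub_surplusReduction_out_integrable
    (hB : ∀ x, B x = if |x| < a then 1 / Real.sqrt (Real.log (1 / min (a - |x|) d₀)) else 0)
    (hd : 0 < d) (hdd₀ : d < d₀) (h2d₀ : 2 * d₀ ≤ 1) (hd₀a : d₀ < a) :
    IntegrableOn (fun t ↦ (1 / Real.sqrt (Real.log (1 / d)) - B (a - d + t)) * weilArchDensity t)
      (Ioi 0) := by
  have hd₀ : 0 < d₀ := hd.trans hdd₀
  have hL₀ : 0 < Real.log (1 / d₀) := stub_surplusReduction_log_pos hd₀ (by linarith)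
  set L₀ : ℝ := Real.log (1 / d₀) with hL₀def
  have hBm := stub_surplusReduction_B_measurable hB
  refine stub_surplusReduction_integrableOn_of_bounds
    ((measurable_const.sub (hBm.comp (measurable_const.add measurable_id))).mul
      measurable_weilArchDensity)
    (δ := d / 2) (C := 1 / (d * (L₀ * Real.sqrt L₀))) (M := 1 / Real.sqrt L₀)
    (by positivity) (fun t ht0 htδ ↦ ?_) (fun t ht ↦ ?_)
  · -- near `0`
    have htd : t < d := by linarith
    have hmono := stub_surplusReduction_W_mono (s₁ := d - t) (s₂ := d) (by linarith) (by linarith)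
      (by linarith)
    have hlip := stub_surplusReduction_W_lipschitz (s₁ := d - t) (s₂ := d) (L := L₀)
      (by linarith) (by linarith) hL₀
      (Real.log_le_log (by positivity) (one_div_le_one_div_of_le hd hdd₀.le))
    rw [sub_sub_cancel] at hlip
    have hρ0 := weilArchDensity_pos ht0
    have hρ1 := stub_surplusReduction_rho_le_inv ht0 (by linarith)
    rw [stub_surplusReduction_B_out_near hB hdd₀ hd₀a ht0.le htd, abs_mul, abs_of_pos hρ0,
      abs_of_nonneg (sub_nonneg.2 hmono)]
    have hX : 1 / Real.sqrt (Real.log (1 / d)) - 1 / Real.sqrt (Real.log (1 / (d - t))) ≤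
        t / (d * (L₀ * Real.sqrt L₀)) :=
      hlip.trans (div_le_div_of_nonneg_left ht0.le (by positivity)
        (mul_le_mul_of_nonneg_right (by linarith) (by positivity)))
    calc _ ≤ t / (d * (L₀ * Real.sqrt L₀)) * (1 / t) := mul_le_mul hX hρ1 hρ0.le (by positivity)
      _ = 1 / (d * (L₀ * Real.sqrt L₀)) := by field_simp
  · -- away from `0`
    have ht0 : 0 < t := by linarith
    have hρ0 := weilArchDensity_pos ht0
    have hb := stub_surplusReduction_B_bounds hB hd₀ h2d₀ (a - d + t)
    have hW0 : 0 ≤ 1 / Real.sqrt (Real.log (1 / d)) := by positivity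
    have hW1 : 1 / Real.sqrt (Real.log (1 / d)) ≤ 1 / Real.sqrt L₀ :=
      stub_surplusReduction_W_mono hd hdd₀.le (by linarith)
    rw [abs_mul, abs_of_pos hρ0]
    refine mul_le_mul_of_nonneg_right (abs_sub_le_iff.2 ⟨?_, ?_⟩) hρ0.le
    · linarith [hb.1]
    · linarith [hb.2]

/-- **Outward (killing) bound**: `∫_{(0,∞)} (W(d) − B(a − d + t))ρ(t) dt ≥ W(d)(½ log(1/d) − 1)`:
the integrand is `≥ 0` on `(0, d]` and equals `W(d)ρ` on `(d, ∞)`, where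
`∫_{(d,∞)} ρ ≥ ½ log(1/d) − 1`. [folklore] -/
theorem stub_surplusReduction_out_bound
    (hB : ∀ x, B x = if |x| < a then 1 / Real.sqrt (Real.log (1 / min (a - |x|) d₀)) else 0)
    (hd : 0 < d) (hdd₀ : d < d₀) (h2d₀ : 2 * d₀ ≤ 1) (hd₀a : d₀ < a) :
    1 / Real.sqrt (Real.log (1 / d)) * (Real.log (1 / d) / 2 - 1) ≤
      ∫ t in Ioi (0 : ℝ), (1 / Real.sqrt (Real.log (1 / d)) - B (a - d + t)) * weilArchDensity t := by
  have hint := stub_surplusReduction_out_integrable hB hd hdd₀ h2d₀ hd₀a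
  set Wd : ℝ := 1 / Real.sqrt (Real.log (1 / d)) with hWd
  have hsplit : ∫ t in Ioi (0 : ℝ), (Wd - B (a - d + t)) * weilArchDensity t =
      (∫ t in Ioc 0 d, (Wd - B (a - d + t)) * weilArchDensity t) +
        ∫ t in Ioi d, (Wd - B (a - d + t)) * weilArchDensity t := by
    rw [← Ioc_union_Ioi_eq_Ioi hd.le, setIntegral_union Ioc_disjoint_Ioi_same measurableSet_Ioi
      (hint.mono_set Ioc_subset_Ioi_self) (hint.mono_set (Ioi_subset_Ioi hd.le))]
  have h1 : 0 ≤ ∫ t in Ioc 0 d, (Wd - B (a - d + t)) * weilArchDensity t := by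
    refine setIntegral_nonneg measurableSet_Ioc fun t ht ↦
      mul_nonneg ?_ (weilArchDensity_pos ht.1).le
    have ht0 : 0 < t := ht.1
    rcases lt_or_eq_of_le ht.2 with h | h
    · rw [stub_surplusReduction_B_out_near hB hdd₀ hd₀a ht0.le h]
      exact sub_nonneg.2 (stub_surplusReduction_W_mono (by linarith) (by linarith) (by linarith))
    · rw [h, stub_surplusReduction_B_out_far hB le_rfl, sub_zero]
      positivity
  have h2 : ∫ t in Ioi d, (Wd - B (a - d + t)) * weilArchDensity t =
      Wd * ∫ t in Ioi d, weilArchDensity t := by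
    rw [← integral_const_mul]
    refine setIntegral_congr_fun measurableSet_Ioi fun t ht ↦ ?_
    simp only [stub_surplusReduction_B_out_far hB (mem_Ioi.1 ht).le, sub_zero]
  have h3 := stub_surplusReduction_rho_killing hd (by linarith : d ≤ 1)
  have h4 : Wd * (Real.log (1 / d) / 2 - 1) ≤ Wd * ∫ t in Ioi d, weilArchDensity t :=
    mul_le_mul_of_nonneg_left h3 (by positivity)
  linarith

/-! ## The inward part `(W(d) − B(a − d − t)) ρ(t)` -/

/-- The inward part is integrable on `(0, ∞)`: on `(0, d₀ − d]` it equals `(W(d) − W(d + t))ρ(t)`,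
bounded by `(t/(d L₀√L₀)) · (1/t)`; on `(d₀ − d, ∞)` it is dominated by `β₀ ρ`. [folklore] -/
theorem stub_surplusReduction_in_integrable
    (hB : ∀ x, B x = if |x| < a then 1 / Real.sqrt (Real.log (1 / min (a - |x|) d₀)) else 0)
    (hd : 0 < d) (hdd₀ : d < d₀) (h2d₀ : 2 * d₀ ≤ 1) (hd₀a : d₀ < a) :
    IntegrableOn (fun t ↦ (1 / Real.sqrt (Real.log (1 / d)) - B (a - d - t)) * weilArchDensity t)
      (Ioi 0) := by
  have hd₀ : 0 < d₀ := hd.trans hdd₀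
  have hL₀ : 0 < Real.log (1 / d₀) := stub_surplusReduction_log_pos hd₀ (by linarith)
  set L₀ : ℝ := Real.log (1 / d₀) with hL₀def
  have hBm := stub_surplusReduction_B_measurable hB
  refine stub_surplusReduction_integrableOn_of_bounds
    ((measurable_const.sub (hBm.comp (measurable_const.sub measurable_id))).mul
      measurable_weilArchDensity)
    (δ := d₀ - d) (C := 1 / (d * (L₀ * Real.sqrt L₀))) (M := 1 / Real.sqrt L₀)
    (by linarith) (fun t ht0 htδ ↦ ?_) (fun t ht ↦ ?_)
  · -- near `0`
    have hmono := stub_surplusReduction_W_mono (s₁ := d) (s₂ := d + t) hd (by linarith)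
      (by linarith)
    have hlip := stub_surplusReduction_W_lipschitz (s₁ := d) (s₂ := d + t) (L := L₀) hd
      (by linarith) hL₀ (Real.log_le_log (by positivity)
        (one_div_le_one_div_of_le (by positivity) (by linarith)))
    rw [add_sub_cancel_left] at hlip
    have hρ0 := weilArchDensity_pos ht0
    have hρ1 := stub_surplusReduction_rho_le_inv ht0 (by linarith)
    rw [stub_surplusReduction_B_in_near hB hd hd₀a ht0.le htδ, abs_mul, abs_of_pos hρ0,
      abs_of_nonpos (sub_nonpos.2 hmono), neg_sub]
    have hX : 1 / Real.sqrt (Real.log (1 / (d + t))) - 1 / Real.sqrt (Real.log (1 / d)) ≤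
        t / (d * (L₀ * Real.sqrt L₀)) :=
      hlip.trans (div_le_div_of_nonneg_left ht0.le (by positivity)
        (mul_le_mul_of_nonneg_right (by linarith) (by positivity)))
    calc _ ≤ t / (d * (L₀ * Real.sqrt L₀)) * (1 / t) := mul_le_mul hX hρ1 hρ0.le (by positivity)
      _ = 1 / (d * (L₀ * Real.sqrt L₀)) := by field_simp
  · -- away from `0`
    have ht0 : 0 < t := by linarith
    have hρ0 := weilArchDensity_pos ht0
    have hb := stub_surplusReduction_B_bounds hB hd₀ h2d₀ (a - d - t)
    have hW0 : 0 ≤ 1 / Real.sqrt (Real.log (1 / d)) := by positivity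
    have hW1 : 1 / Real.sqrt (Real.log (1 / d)) ≤ 1 / Real.sqrt L₀ :=
      stub_surplusReduction_W_mono hd hdd₀.le (by linarith)
    rw [abs_mul, abs_of_pos hρ0]
    refine mul_le_mul_of_nonneg_right (abs_sub_le_iff.2 ⟨?_, ?_⟩) hρ0.le
    · linarith [hb.1]
    · linarith [hb.2]

/-- **Inward (pull and plateau) bound**:
`∫_{(0,∞)} (W(d) − B(a − d − t))ρ(t) dt ≥ −J − β₀ d₀ − (β₀ − W(d))(½ log(1/(d₀ − d)) + 3)`:
on `(0, d₀ − d]` the integrand is `−(W(d+t) − W(d))ρ ≥ −(W(d+t) − W(d))/(2t) − β₀`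
(`ρ ≤ 1/(2t) + 1`, `0 ≤ W(d+t) − W(d) ≤ β₀`); on `(d₀ − d, ∞)` it is `≥ (W(d) − β₀)ρ` and
`∫_{(d₀−d,∞)} ρ ≤ ½ log(1/(d₀ − d)) + 3`. [folklore] -/
theorem stub_surplusReduction_in_bound
    (hB : ∀ x, B x = if |x| < a then 1 / Real.sqrt (Real.log (1 / min (a - |x|) d₀)) else 0)
    (hd : 0 < d) (hdd₀ : d < d₀) (h2d₀ : 2 * d₀ ≤ 1) (hd₀a : d₀ < a) :
    -(∫ s in (0 : ℝ)..(d₀ - d),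
        (1 / Real.sqrt (Real.log (1 / (d + s))) - 1 / Real.sqrt (Real.log (1 / d))) / (2 * s))
      - d₀ / Real.sqrt (Real.log (1 / d₀))
      - (1 / Real.sqrt (Real.log (1 / d₀)) - 1 / Real.sqrt (Real.log (1 / d))) *
          (Real.log (1 / (d₀ - d)) / 2 + 3) ≤
      ∫ t in Ioi (0 : ℝ), (1 / Real.sqrt (Real.log (1 / d)) - B (a - d - t)) * weilArchDensity t := by
  have hd₀ : 0 < d₀ := hd.trans hdd₀
  have hδ0 : 0 < d₀ - d := by linarith
  have hint := stub_surplusReduction_in_integrable hB hd hdd₀ h2d₀ hd₀a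
  have hJ := stub_surplusReduction_J_integrable hd hdd₀ h2d₀
  rw [intervalIntegral.integral_of_le hδ0.le]
  set Wd : ℝ := 1 / Real.sqrt (Real.log (1 / d)) with hWd
  set β₀ : ℝ := 1 / Real.sqrt (Real.log (1 / d₀)) with hβ₀
  have hWd0 : 0 ≤ Wd := by positivity
  have hβ0 : 0 ≤ β₀ := by positivity
  have hWβ : Wd ≤ β₀ := stub_surplusReduction_W_mono hd hdd₀.le (by linarith)
  have e0 : d₀ / Real.sqrt (Real.log (1 / d₀)) = β₀ * d₀ := by
    rw [hβ₀]
    ring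
  have hsplit : ∫ t in Ioi (0 : ℝ), (Wd - B (a - d - t)) * weilArchDensity t =
      (∫ t in Ioc 0 (d₀ - d), (Wd - B (a - d - t)) * weilArchDensity t) +
        ∫ t in Ioi (d₀ - d), (Wd - B (a - d - t)) * weilArchDensity t := by
    rw [← Ioc_union_Ioi_eq_Ioi hδ0.le, setIntegral_union Ioc_disjoint_Ioi_same measurableSet_Ioi
      (hint.mono_set Ioc_subset_Ioi_self) (hint.mono_set (Ioi_subset_Ioi hδ0.le))]
  -- the pull on `(0, d₀ − d]`
  have hnear : -(∫ t in Ioc 0 (d₀ - d), (1 / Real.sqrt (Real.log (1 / (d + t))) - Wd) / (2 * t))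
      - β₀ * (d₀ - d) ≤ ∫ t in Ioc 0 (d₀ - d), (Wd - B (a - d - t)) * weilArchDensity t := by
    have hc : IntegrableOn (fun _ : ℝ ↦ β₀) (Ioc 0 (d₀ - d)) :=
      integrableOn_const measure_Ioc_lt_top.ne
    have hle : ∫ t in Ioc 0 (d₀ - d),
        -((1 / Real.sqrt (Real.log (1 / (d + t))) - Wd) / (2 * t) + β₀) ≤
        ∫ t in Ioc 0 (d₀ - d), (Wd - B (a - d - t)) * weilArchDensity t := by
      refine setIntegral_mono_on (hJ.add hc).neg (hint.mono_set Ioc_subset_Ioi_self)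
        measurableSet_Ioc fun t ht ↦ ?_
      have ht0 : 0 < t := ht.1
      rw [stub_surplusReduction_B_in_near hB hd hd₀a ht0.le ht.2]
      have hρ := (stub_surplusReduction_rho_bounds ht0 (by linarith [ht.2])).2
      have hX0 : 0 ≤ 1 / Real.sqrt (Real.log (1 / (d + t))) - Wd :=
        sub_nonneg.2 (stub_surplusReduction_W_mono hd (by linarith) (by linarith [ht.2]))
      have hX1 : 1 / Real.sqrt (Real.log (1 / (d + t))) ≤ β₀ :=
        stub_surplusReduction_W_mono (by linarith) (by linarith [ht.2]) (by linarith)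
      have h1 := mul_le_mul_of_nonneg_left hρ hX0
      have e : (1 / Real.sqrt (Real.log (1 / (d + t))) - Wd) * (1 / (2 * t) + 1) =
          (1 / Real.sqrt (Real.log (1 / (d + t))) - Wd) / (2 * t) +
            (1 / Real.sqrt (Real.log (1 / (d + t))) - Wd) := by ring
      linarith
    have hval : ∫ t in Ioc 0 (d₀ - d),
        -((1 / Real.sqrt (Real.log (1 / (d + t))) - Wd) / (2 * t) + β₀) =
        -(∫ t in Ioc 0 (d₀ - d), (1 / Real.sqrt (Real.log (1 / (d + t))) - Wd) / (2 * t))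
          - β₀ * (d₀ - d) := by
      rw [integral_neg, integral_add hJ hc, setIntegral_const, Real.volume_real_Ioc_of_le hδ0.le,
        smul_eq_mul]
      ring
    linarith
  -- the plateau and beyond, `(d₀ − d, ∞)`
  have hfar : (Wd - β₀) * (Real.log (1 / (d₀ - d)) / 2 + 3) ≤
      ∫ t in Ioi (d₀ - d), (Wd - B (a - d - t)) * weilArchDensity t := by
    have hρi := integrableOn_weilArchDensity_Ioi hδ0
    have hle : ∫ t in Ioi (d₀ - d), (Wd - β₀) * weilArchDensity t ≤
        ∫ t in Ioi (d₀ - d), (Wd - B (a - d - t)) * weilArchDensity t := by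
      refine setIntegral_mono_on (hρi.const_mul _) (hint.mono_set (Ioi_subset_Ioi hδ0.le))
        measurableSet_Ioi fun t ht ↦ ?_
      have ht0 : 0 < t := hδ0.trans ht
      refine mul_le_mul_of_nonneg_right ?_ (weilArchDensity_pos ht0).le
      have hb := (stub_surplusReduction_B_bounds hB hd₀ h2d₀ (a - d - t)).2
      rw [← hβ₀] at hb
      linarith
    rw [integral_const_mul] at hle
    have hT := stub_surplusReduction_rho_tail hδ0 (by linarith)
    have h2 := mul_le_mul_of_nonpos_left hT (sub_nonpos.2 hWβ)
    linarith
  have hβd : 0 ≤ β₀ * d := mul_nonneg hβ0 hd.le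
  rw [e0]
  linarith

/-! ## Assembly -/

/-- The stub at the positive layer point `y = a − d`: integrability of the integrand of `(L B)(y)`
and the three-piece lower bound (outward + inward). [folklore] -/
theorem stub_surplusReduction_pos
    (hB : ∀ x, B x = if |x| < a then 1 / Real.sqrt (Real.log (1 / min (a - |x|) d₀)) else 0)
    (hd : 0 < d) (hdd₀ : d < d₀) (h2d₀ : 2 * d₀ ≤ 1) (hd₀a : d₀ < a) :
    IntegrableOn (fun t ↦ (2 * B (a - d) - B (a - d + t) - B (a - d - t)) * weilArchDensity t)
        (Ioi 0) ∧
      1 / Real.sqrt (Real.log (1 / d)) * (Real.log (1 / d) / 2 - 1)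
          - (∫ s in (0 : ℝ)..(d₀ - d),
              (1 / Real.sqrt (Real.log (1 / (d + s))) - 1 / Real.sqrt (Real.log (1 / d))) / (2 * s))
          - d₀ / Real.sqrt (Real.log (1 / d₀))
          - (1 / Real.sqrt (Real.log (1 / d₀)) - 1 / Real.sqrt (Real.log (1 / d))) *
              (Real.log (1 / (d₀ - d)) / 2 + 3)
        ≤ ∫ t in Ioi (0 : ℝ), (2 * B (a - d) - B (a - d + t) - B (a - d - t)) * weilArchDensity t := by
  have hout := stub_surplusReduction_out_integrable hB hd hdd₀ h2d₀ hd₀a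
  have hin := stub_surplusReduction_in_integrable hB hd hdd₀ h2d₀ hd₀a
  have h1 := stub_surplusReduction_out_bound hB hd hdd₀ h2d₀ hd₀a
  have h2 := stub_surplusReduction_in_bound hB hd hdd₀ h2d₀ hd₀a
  have hc := stub_surplusReduction_B_center hB hd hdd₀ hd₀a
  have e : (fun t ↦ (2 * B (a - d) - B (a - d + t) - B (a - d - t)) * weilArchDensity t) =
      fun t ↦ (1 / Real.sqrt (Real.log (1 / d)) - B (a - d + t)) * weilArchDensity t +
        (1 / Real.sqrt (Real.log (1 / d)) - B (a - d - t)) * weilArchDensity t := by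
    funext t
    rw [hc]
    ring
  rw [e, integral_add hout hin]
  exact ⟨hout.add hin, by linarith⟩

/-- **Stub S1a `stub_surplusReduction` — the three-piece lower bound for the barrier's jump
operator** (line `borderline-barrier` of the crux `WeilWindowFlow.WindowLipschitz`). For the
explicit two-scale barrier `B` of the window `a` frozen at depth `d₀` (`2d₀ ≤ 1`, `d₀ < a`) and a
point `y` of the edge layer at depth `d = a − |y| ∈ (0, d₀)`, the integrand of
`(L B)(y) = ∫₀^∞ (2B(y) − B(y+t) − B(y−t)) ρ(t) dt` is integrable on `(0,∞)` and
`(L B)(y) ≥ W(d)(½ log(1/d) − 1) − J − β₀ d₀ − (β₀ − W(d))(½ log(1/(d₀−d)) + 3)`,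
`W(s) = 1/√(log(1/s))`, `β₀ = W(d₀)`, `J = ∫₀^{d₀−d} (W(d+s) − W(d)) ds/(2s)`. By evenness of `B`
the integrand for `y = −(a − d)` is that for `y = a − d` (`stub_surplusReduction_pos`).
[folklore] -/
theorem stub_surplusReduction :
    ∀ (a d₀ d : ℝ) (B : ℝ → ℝ), 0 < d → d < d₀ → 2 * d₀ ≤ 1 → d₀ < a →
      (∀ x, B x = if |x| < a then 1 / Real.sqrt (Real.log (1 / min (a - |x|) d₀)) else 0) →
      ∀ y : ℝ, |y| = a - d →
        IntegrableOn (fun t ↦ (2 * B y - B (y + t) - B (y - t)) * weilArchDensity t) (Ioi 0) ∧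
        1 / Real.sqrt (Real.log (1 / d)) * (Real.log (1 / d) / 2 - 1)
            - (∫ s in (0 : ℝ)..(d₀ - d),
                (1 / Real.sqrt (Real.log (1 / (d + s))) - 1 / Real.sqrt (Real.log (1 / d))) / (2 * s))
            - d₀ / Real.sqrt (Real.log (1 / d₀))
            - (1 / Real.sqrt (Real.log (1 / d₀)) - 1 / Real.sqrt (Real.log (1 / d))) *
                (Real.log (1 / (d₀ - d)) / 2 + 3)
          ≤ ∫ t in Ioi (0 : ℝ), (2 * B y - B (y + t) - B (y - t)) * weilArchDensity t := by
  intro a d₀ d B hd hdd₀ h2d₀ hd₀a hB y hy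
  have key : (fun t ↦ (2 * B y - B (y + t) - B (y - t)) * weilArchDensity t) =
      fun t ↦ (2 * B (a - d) - B (a - d + t) - B (a - d - t)) * weilArchDensity t := by
    funext t
    rcases (abs_eq (by linarith : (0 : ℝ) ≤ a - d)).1 hy with h | h
    · rw [h]
    · have e1 : B y = B (a - d) := by
        rw [h, stub_surplusReduction_B_even hB]
      have e2 : B (y + t) = B (a - d - t) := by
        rw [h, ← stub_surplusReduction_B_even hB (-(a - d) + t)]
        congr 1
        ring
      have e3 : B (y - t) = B (a - d + t) := by
        rw [h, ← stub_surplusReduction_B_even hB (-(a - d) - t)]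
        congr 1
        ring
      rw [e1, e2, e3]
      ring
  rw [key]
  exact stub_surplusReduction_pos hB hd hdd₀ h2d₀ hd₀a

end Summit.RiemannHypothesis.RiemannHypothesis.Theorems.WeilWindowFlowWindowLipschitz

end
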